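import Summits.QuantumFields.YangMills.Theorems.UnitScaleTiltProp7NSIntertwinerOfRecord
import Summits.QuantumFields.YangMills.Theorems.UnitScaleTiltProp7FrameLevelOnto
import Summits.QuantumFields.YangMills.Theorems.UnitScaleTiltProp7SymAvgTwSymSlice
import Summits.QuantumFields.YangMills.Theorems.PoincareLipschitzHierAlignWords
import HarnessLib

/-!
# Route `UnitScaleTilt`, crux K1 «MinimiserStabilityRegPr» (stmt-QuantumFields-19200), EX positivity block — **THE TOP NESTED COVARIANT MEAN IS ONTO: THE AVERAGING SEQUENCE OF A
# POINT MASS AT A TOP CENTRE IS A (RESCALED) POINT MASS AT EVERY LEVEL**, hence every coarse gauge section `c` on `T^{(K−n)}` is `Q″(toL2S λ)` for an explicit `λ`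
# ([Balaban1985BackgroundPropagators] (3.19) p.393 «the operators `Q′_j` … are onto», the parameter-averaging twin of lit `B9Eq319Onto`, for the averaging OF RECORD)

Cell `ym3-torus` (HUMAN RULING D-0037; rung R3 — NOT d = 4, NOT infinite volume, NOT a mass gap, NOT Clay).  Width seat `ym3-torus-px13` (gen 9).  THEOREMS ONLY (0 `def`, 0 `sorry`);
`--supports stmt-QuantumFields-19200 --as helper`; count-neutral.  Nothing of [B9] §3, N06, `hThm2S`, EX or the crux is asserted.

THE POINT.  In the `meanCLM` recursion of ✓`Prop7SymAvgTwSGaugeDir.QTwS_gaugeDir_of_avgSeq` (`ns (j+1) y = ns j ŷ − mean_i (ns j ŷ − T_i·ns j (x_i)·T_i⁻¹)`, `x_i = blockSite y i.1`,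
✓`Prop7FrameLevelOnto.transl_emb_disp_stairWord_eq_blockSite`) the block of `y` meets the support of a point mass at a CENTRE only at the centre offset `r₀ = (L−1)∕2` (✓`offs_emb`,
✓`offs_blockSite`), where the stair is empty (`off r₀ = 0`, ✓`PoincareLipschitzHierAlignWords.stairWord_zero`, lit `holT_nil`) so the transport is `1`; the `(d!)²` centre indices of
`Idx P = (Fin d → Fin L) × Perm × Perm` out of `L^d(d!)²` give the factor `L^{−d}`.  So `δ_{x̂⁽ᵏ⁾y⋆}·v ↦ … ↦ δ_{y⋆}·(L^{−d})^k v`, and by linearity (✓`Prop7NSIntertwinerOfRecord.exists_linear_avgSeq`)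
every `c` has the preimage `λ = Σ_y (L^{d})^k·δ_{x̂⁽ᵏ⁾y}·c(y)`.  Consumers: the converse `R_S = projR (covLapSite U₀) Q″ ⟹ Lift` (sequel file), and any N06 supplier needing print's «`Q′` onto».

WHAT IS PROVED (ns `…Theorems.Prop7TopMeanDeltaPreimage`):
* §1 (generic `P`, normed `ℂ`-algebra `𝔸`, transports `T j y i` with `T j y i = 1` whenever `i.1 = r₀`) `off_ctr`, `blockSite_ctr_eq_emb`, `eq_ctr_of_blockSite_eq_emb`, `exists_emb_of_embIter_eq`,
  `meanCLM_ite_fst_eq`, ★★ `avgSeq_of_single` (the point-mass averaging sequence in closed form at every level `j ≤ k`).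
* §2 (T³ member; `Q″` ANY linear map with ✓p734803's top-mean property (iii)) ★★ `topMean_toL2S_single` (`Q″ (toL2S (δ_{embIter (K−n) y}·v)) = δ_y·((card (Fin 3 → Fin L))⁻¹)^{K−n}•v`),
  ★★★ `exists_preimage_topMean` (`∀ c, ∃ lam, Q″ (toL2S lam) = c`), ★ `surjective_topMean`.
HONEST SCOPE.  Bookkeeping; no estimate; the transports enter only through «centre transport `= 1`».  Rung R3, not Clay; YM gap NOT proved.

References: T. Bałaban, CMP **99** (1985) 389–434 [Balaban1985BackgroundPropagators] ((3.19) p.393, (3.115) p.418); CMP **98** (1985) 17–51 [Balaban1985Averaging] ((97) p.32);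
CMP **109** (1987) 249–301 [Balaban1987RG1] ((0.1)–(0.3) pp.251–252).
-/

set_option autoImplicit false

noncomputable section

open scoped BigOperators Matrix.Norms.L2Operator

namespace Summit.QuantumFields.YangMills.Theorems.Prop7TopMeanDeltaPreimage

open NormedSpace
open Literature.MathematicalPhysics.QuantumFieldTheory.Balaban1983to89
open Literature.MathematicalPhysics.QuantumFieldTheory.Balaban1983to89.T3ContinuumYM3Torus
open T4Continuum BlockAveraging
open BlockAveraging (Idx)
open B7Prop1Explicit (disp)
open B7Eq78Linearization (conjR conjR_apply)
open B10Eq27TorusAxialLog (holT transl holT_nil)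
open B7TransferAnalyticMean (meanCLM meanCLM_apply)
open B11Eq103H1Complex (SiteL2K)
open B15DeterminingSets (embIter)
open Summit.QuantumFields.YangMills.Theorems.Prop8Chart (emlIterU)
open T3SectALandauChart (bgUnits)
open Summit.QuantumFields.YangMills.Theorems.Prop7SectET3Transport (periodsT3)
open Summit.QuantumFields.YangMills.Theorems.Prop7SectET3HilbertLetters (W₂ toL2S)
open Summit.QuantumFields.YangMills.Theorems.Prop7FrameLevelOnto (offs_emb offs_blockSite transl_emb_disp_stairWord_eq_blockSite)
open Summit.QuantumFields.YangMills.Theorems.Prop7SymAvgTwSymSlice (embIter_injective)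
open Summit.QuantumFields.YangMills.Theorems.PoincareLipschitzHierAlignWords (stairWord_zero)
open Summit.QuantumFields.YangMills.Theorems.Prop7NSIntertwinerOfRecord (exists_linear_avgSeq)

/-! ## §1 The averaging sequence of a point mass at a top centre -/

section Generic

variable {P : Params} {𝔸 : Type*} [NormedRing 𝔸] [NormedAlgebra ℂ 𝔸]

/-- The centred offset of the centre index `r₀ = (L−1)∕2` vanishes: `off r₀ = 0`. [cite: Balaban1987RG1, (0.3) p.252] -/
theorem off_ctr : off (P := P) (fun _ : Fin P.d => (⟨(P.L - 1) / 2, by have := P.L_pos; omega⟩ : Fin P.L)) = fun _ : Fin P.d => (0 : ℤ) := by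
  funext ν
  simp [off]

/-- The block site of `y` at the centre offset is the centre `emb y`. [cite: Balaban1987RG1, (0.1)-(0.3) pp.251-252] -/
theorem blockSite_ctr_eq_emb {j : ℕ} (hj : j + 1 ≤ P.m + P.K) (y : Site P (j + 1)) :
    Site.blockSite y (fun _ : Fin P.d => (⟨(P.L - 1) / 2, by have := P.L_pos; omega⟩ : Fin P.L)) = emb y := by
  have h := Prop7FrameLevelOnto.blockSite_blockOf_offs hj (emb y)
  rw [Site.blockOf_emb hj, offs_emb hj y] at h
  exact h

/-- Conversely, the only offset whose block site is the centre is `r₀`. [cite: Balaban1987RG1, (0.1)-(0.3) pp.251-252] -/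
theorem eq_ctr_of_blockSite_eq_emb {j : ℕ} (hj : j + 1 ≤ P.m + P.K) (y : Site P (j + 1)) (r : Fin P.d → Fin P.L) (h : Site.blockSite y r = emb y) :
    r = fun _ : Fin P.d => (⟨(P.L - 1) / 2, by have := P.L_pos; omega⟩ : Fin P.L) := by
  have h1 := offs_blockSite hj y r
  rw [h, offs_emb hj y] at h1
  exact h1.symm

/-- **THE LEVEL-`j` ANCESTOR**: if `embIter j z = embIter k w` with `j < k`, then `z = emb z₁` for a (unique) level-`(j+1)` site `z₁` over `w` (`embIter (j+1) z₁ = embIter k w`).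
[cite: Balaban1987RG1, (0.1) p.251] -/
theorem exists_emb_of_embIter_eq : ∀ (k : ℕ), k ≤ P.m + P.K → ∀ (j : ℕ), j < k → ∀ (w : Site P k) (z : Site P j),
    embIter j z = embIter k w → ∃ z₁ : Site P (j + 1), z = emb z₁ ∧ embIter (j + 1) z₁ = embIter k w
  | 0, _, _, hjk, _, _, _ => absurd hjk (Nat.not_lt_zero _)
  | k + 1, hk, j, hjk, w, z, h => by
    by_cases hj : j = k
    · subst hj
      exact ⟨w, embIter_injective j (by omega) h, rfl⟩
    · exact exists_emb_of_embIter_eq k (by omega) j (by omega) (emb w) z h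

/-- **THE CENTRE INDICES CARRY WEIGHT `L^{−d}`**: `mean_i (if i.1 = r then w else 0) = (card (Fin d → Fin L))⁻¹ • w` on `Idx P = (Fin d → Fin L) × Perm × Perm`. [cite: Balaban1987RG1, (0.4) p.253] -/
theorem meanCLM_ite_fst_eq (r : Fin P.d → Fin P.L) (w : 𝔸) :
    meanCLM (Idx P) 𝔸 (fun i : Idx P => if i.1 = r then w else 0) = ((Fintype.card (Fin P.d → Fin P.L) : ℂ)⁻¹) • w := by
  classical
  rw [meanCLM_apply]
  have hsum : ∑ i : Idx P, (if i.1 = r then w else 0)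
      = (Fintype.card (Equiv.Perm (Fin P.d) × Equiv.Perm (Fin P.d)) : ℂ) • w := by
    rw [← Finset.sum_filter, Finset.sum_const, ← Nat.cast_smul_eq_nsmul ℂ]
    congr 2
    rw [← Fintype.card_subtype, Fintype.card_congr (Equiv.prodSubtypeFstEquivSubtypeProd (p := fun a => a = r)), Fintype.card_prod,
      Fintype.card_subtype_eq, one_mul]
  have hcard : (Fintype.card (Idx P) : ℂ) = (Fintype.card (Fin P.d → Fin P.L) : ℂ) * (Fintype.card (Equiv.Perm (Fin P.d) × Equiv.Perm (Fin P.d)) : ℂ) := by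
    rw [show Fintype.card (Idx P) = Fintype.card (Fin P.d → Fin P.L) * Fintype.card (Equiv.Perm (Fin P.d) × Equiv.Perm (Fin P.d)) from Fintype.card_prod _ _]
    push_cast
    rfl
  have hB : (Fintype.card (Equiv.Perm (Fin P.d) × Equiv.Perm (Fin P.d)) : ℂ) ≠ 0 := Nat.cast_ne_zero.2 Fintype.card_ne_zero
  rw [hsum, hcard, smul_smul, mul_inv, mul_assoc, inv_mul_cancel₀ hB, mul_one]

/-- ★★ **THE AVERAGING SEQUENCE OF A POINT MASS AT A TOP CENTRE, IN CLOSED FORM**: if `ns 0 = δ_{embIter k y⋆}·v` and `ns` obeys the `meanCLM` recursion of ✓`QTwS_gaugeDir_of_avgSeq` with transports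
equal to `1` at the centre indices, then for every `j ≤ k`, `ns j = δ_{ancestor_j(y⋆)}·((card (Fin d → Fin L))⁻¹)^j • v` — written as `z ↦ if embIter j z = embIter k y⋆ then … else 0`.
[cite: Balaban1985BackgroundPropagators, (3.19) p.393; Balaban1985Averaging, (97) p.32; Balaban1987RG1, (0.3) p.252] -/
theorem avgSeq_of_single {k : ℕ} (hk : k ≤ P.m + P.K) (T : (j : ℕ) → Site P (j + 1) → Idx P → 𝔸ˣ)
    (hT0 : ∀ (j : ℕ) (y : Site P (j + 1)) (i : Idx P), i.1 = (fun _ : Fin P.d => (⟨(P.L - 1) / 2, by have := P.L_pos; omega⟩ : Fin P.L)) → T j y i = 1)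
    (ystar : Site P k) (v : 𝔸) (ns : (j : ℕ) → Site P j → 𝔸) (h0 : ns 0 = fun z => if z = embIter k ystar then v else 0)
    (hsucc : ∀ (j : ℕ) (y : Site P (j + 1)), ns (j + 1) y = ns j (emb y) - meanCLM (Idx P) 𝔸 fun i : Idx P =>
        ns j (emb y) - ((T j y i : 𝔸ˣ) : 𝔸) * ns j (transl (emb y) (disp (stairWord i.2.1 (off i.1)))) * (((T j y i)⁻¹ : 𝔸ˣ) : 𝔸)) :
    ∀ j : ℕ, j ≤ k → ns j = fun z => if embIter j z = embIter k ystar then ((((Fintype.card (Fin P.d → Fin P.L) : ℂ))⁻¹) ^ j) • v else 0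
  | 0, _ => by
    rw [h0]
    funext z
    simp only [pow_zero, one_smul]
    rfl
  | j + 1, hjk => by
    classical
    have ih := avgSeq_of_single hk T hT0 ystar v ns h0 hsucc j (by omega)
    have hj1 : j + 1 ≤ P.m + P.K := by omega
    set c : ℂ := ((Fintype.card (Fin P.d → Fin P.L) : ℂ))⁻¹ with hc
    set r₀ : Fin P.d → Fin P.L := fun _ => (⟨(P.L - 1) / 2, by have := P.L_pos; omega⟩ : Fin P.L) with hr₀
    funext y
    rw [hsucc, ih]
    simp only [transl_emb_disp_stairWord_eq_blockSite]
    -- `embIter j (emb y) = embIter (j+1) y`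
    have hemb : embIter j (emb y) = embIter (j + 1) y := rfl
    by_cases hy : embIter (j + 1) y = embIter k ystar
    · -- the block of `y` meets the support exactly at the centre
      have hsite : ∀ i : Idx P, (embIter j (Site.blockSite y i.1) = embIter k ystar) ↔ i.1 = r₀ := by
        intro i
        constructor
        · intro hi
          rw [← hy, ← hemb] at hi
          exact eq_ctr_of_blockSite_eq_emb hj1 y i.1 (embIter_injective j (by omega) hi)
        · intro hi
          rw [hi, hr₀, blockSite_ctr_eq_emb hj1 y, hemb, hy]
      have hfun : (fun i : Idx P => (if embIter j (emb y) = embIter k ystar then c ^ j • v else 0)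
            - ((T j y i : 𝔸ˣ) : 𝔸) * (if embIter j (Site.blockSite y i.1) = embIter k ystar then c ^ j • v else 0) * (((T j y i)⁻¹ : 𝔸ˣ) : 𝔸))
          = (fun _ : Idx P => c ^ j • v) - (fun i : Idx P => if i.1 = r₀ then c ^ j • v else 0) := by
        funext i
        rw [Pi.sub_apply, hemb, if_pos hy]
        by_cases hi : i.1 = r₀
        · rw [if_pos ((hsite i).2 hi), if_pos hi, hT0 j y i hi, Units.val_one, inv_one, Units.val_one, one_mul, mul_one]
        · rw [if_neg (fun h' => hi ((hsite i).1 h')), if_neg hi, mul_zero, zero_mul]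
      rw [hfun, map_sub, meanCLM_ite_fst_eq, hemb, if_pos hy, if_pos hy]
      have hconst : meanCLM (Idx P) 𝔸 (fun _ : Idx P => c ^ j • v) = c ^ j • v := by
        rw [meanCLM_apply, Finset.sum_const, Finset.card_univ, ← Nat.cast_smul_eq_nsmul ℂ, smul_smul,
          inv_mul_cancel₀ (Nat.cast_ne_zero.2 Fintype.card_ne_zero), one_smul]
      rw [hconst, ← hc, pow_succ, mul_smul, smul_comm (c ^ j) c v]
      abel
    · -- the block of `y` misses the support
      have hzero : ∀ i : Idx P, ¬ embIter j (Site.blockSite y i.1) = embIter k ystar := by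
        intro i hi
        obtain ⟨z₁, hz₁, hz₁'⟩ := exists_emb_of_embIter_eq k hk j (by omega) ystar (Site.blockSite y i.1) hi
        have hyz : y = z₁ := by rw [← Site.blockOf_blockSite hj1 y i.1, hz₁, Site.blockOf_emb hj1]
        exact hy (by rw [hyz, hz₁'])
      have hne : ¬ embIter j (emb y) = embIter k ystar := by rw [hemb]; exact hy
      have hfun : (fun i : Idx P => (if embIter j (emb y) = embIter k ystar then c ^ j • v else 0)
            - ((T j y i : 𝔸ˣ) : 𝔸) * (if embIter j (Site.blockSite y i.1) = embIter k ystar then c ^ j • v else 0) * (((T j y i)⁻¹ : 𝔸ˣ) : 𝔸))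
          = fun _ : Idx P => 0 := by
        funext i
        rw [if_neg hne, if_neg (hzero i), mul_zero, zero_mul, sub_zero]
      rw [hfun, if_neg hne, if_neg hy]
      have h0' : meanCLM (Idx P) 𝔸 (fun _ : Idx P => (0 : 𝔸)) = 0 := by
        rw [show (fun _ : Idx P => (0 : 𝔸)) = 0 from rfl, map_zero]
      rw [h0', sub_zero]

end Generic

/-! ## §2 At the T³ member: the top nested mean is onto -/

section T3

variable (F : T3Family) {n K : ℕ}

/-- ★★ **A POINT MASS AT A TOP CENTRE HAS TOP MEAN A POINT MASS**: for any linear `Q″` with the top-mean property (iii) of ✓`Prop7NSIntertwinerOfRecord.exists_intertwiner_of_regPr`,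
`Q″ (toL2S (δ_{embIter (K−n) y}·v)) = δ_y·c^{K−n}•v`, `c = (card (Fin 3 → Fin L))⁻¹ = L^{−3}`. [cite: Balaban1985BackgroundPropagators, (3.19) p.393; Balaban1985Averaging, (97) p.32] -/
theorem topMean_toL2S_single (h : n ≤ K) {c₀ : ℝ} (U₀ : GaugeField (F.P K) 0 (Matrix.specialUnitaryGroup (Fin 2) ℂ))
    (Q'' : SiteL2K ℂ 3 (periodsT3 F K) c₀ W₂ →ₗ[ℂ] (Site (F.P K) (K - n) → Matrix (Fin 2) (Fin 2) ℂ))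
    (htop : ∀ (lam : Site (F.P K) 0 → Matrix (Fin 2) (Fin 2) ℂ) (ns : (j : ℕ) → Site (F.P K) j → Matrix (Fin 2) (Fin 2) ℂ), ns 0 = lam →
      (∀ (j : ℕ) (y : Site (F.P K) (j + 1)), ns (j + 1) y = ns j (emb y) - meanCLM (Idx (F.P K)) (Matrix (Fin 2) (Fin 2) ℂ) fun i : Idx (F.P K) =>
        ns j (emb y) - ((holT (emlIterU j (bgUnits F K U₀)) (emb y) (stairWord i.2.1 (off i.1)) : (Matrix (Fin 2) (Fin 2) ℂ)ˣ) : Matrix (Fin 2) (Fin 2) ℂ) *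
          ns j (transl (emb y) (disp (stairWord i.2.1 (off i.1)))) * (((holT (emlIterU j (bgUnits F K U₀)) (emb y) (stairWord i.2.1 (off i.1)))⁻¹ : (Matrix (Fin 2) (Fin 2) ℂ)ˣ) : Matrix (Fin 2) (Fin 2) ℂ)) →
      ns (K - n) = Q'' (toL2S F K c₀ lam))
    (ystar : Site (F.P K) (K - n)) (v : Matrix (Fin 2) (Fin 2) ℂ) :
    Q'' (toL2S F K c₀ (fun z => if z = embIter (K - n) ystar then v else 0))
      = fun w => if w = ystar then ((((Fintype.card (Fin (F.P K).d → Fin (F.P K).L) : ℂ))⁻¹) ^ (K - n)) • v else 0 := by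
  classical
  have hk : K - n ≤ (F.P K).m + (F.P K).K := by show K - n ≤ F.m + K; omega
  set T : (j : ℕ) → Site (F.P K) (j + 1) → Idx (F.P K) → (Matrix (Fin 2) (Fin 2) ℂ)ˣ :=
    fun j y i => holT (emlIterU j (bgUnits F K U₀)) (emb y) (stairWord i.2.1 (off i.1)) with hTdef
  have hT0 : ∀ (j : ℕ) (y : Site (F.P K) (j + 1)) (i : Idx (F.P K)),
      i.1 = (fun _ : Fin (F.P K).d => (⟨((F.P K).L - 1) / 2, by have := (F.P K).L_pos; omega⟩ : Fin (F.P K).L)) → T j y i = 1 := by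
    intro j y i hi
    show holT (emlIterU j (bgUnits F K U₀)) (emb y) (stairWord i.2.1 (off i.1)) = 1
    rw [hi, off_ctr, stairWord_zero, holT_nil]
  obtain ⟨N, hN0, hNsucc⟩ := exists_linear_avgSeq (P := F.P K) (𝔸 := Matrix (Fin 2) (Fin 2) ℂ) T
  set lam : Site (F.P K) 0 → Matrix (Fin 2) (Fin 2) ℂ := fun z => if z = embIter (K - n) ystar then v else 0 with hlam
  have hseq := avgSeq_of_single hk T hT0 ystar v (fun j => N j lam) (hN0 lam) (fun j y => hNsucc j lam y) (K - n) le_rfl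
  rw [← htop lam (fun j => N j lam) (hN0 lam) (fun j y => hNsucc j lam y)]
  show N (K - n) lam = _
  rw [hseq]
  funext w
  by_cases hw : w = ystar
  · rw [if_pos hw, if_pos (by rw [hw])]
  · rw [if_neg hw, if_neg (fun h' => hw (embIter_injective (K - n) hk h'))]

/-- ★★★ **THE TOP NESTED MEAN IS ONTO** («`Q′` is onto», (3.19)): for any linear `Q″` with the top-mean property (iii), every coarse gauge section `c` on `T^{(K−n)}` is `Q″ (toL2S λ)` for
`λ = Σ_y c^{−(K−n)}·δ_{embIter (K−n) y}·c(y)`. [cite: Balaban1985BackgroundPropagators, (3.19) p.393, (3.115) p.418] -/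
theorem exists_preimage_topMean (h : n ≤ K) {c₀ : ℝ} (U₀ : GaugeField (F.P K) 0 (Matrix.specialUnitaryGroup (Fin 2) ℂ))
    (Q'' : SiteL2K ℂ 3 (periodsT3 F K) c₀ W₂ →ₗ[ℂ] (Site (F.P K) (K - n) → Matrix (Fin 2) (Fin 2) ℂ))
    (htop : ∀ (lam : Site (F.P K) 0 → Matrix (Fin 2) (Fin 2) ℂ) (ns : (j : ℕ) → Site (F.P K) j → Matrix (Fin 2) (Fin 2) ℂ), ns 0 = lam →
      (∀ (j : ℕ) (y : Site (F.P K) (j + 1)), ns (j + 1) y = ns j (emb y) - meanCLM (Idx (F.P K)) (Matrix (Fin 2) (Fin 2) ℂ) fun i : Idx (F.P K) =>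
        ns j (emb y) - ((holT (emlIterU j (bgUnits F K U₀)) (emb y) (stairWord i.2.1 (off i.1)) : (Matrix (Fin 2) (Fin 2) ℂ)ˣ) : Matrix (Fin 2) (Fin 2) ℂ) *
          ns j (transl (emb y) (disp (stairWord i.2.1 (off i.1)))) * (((holT (emlIterU j (bgUnits F K U₀)) (emb y) (stairWord i.2.1 (off i.1)))⁻¹ : (Matrix (Fin 2) (Fin 2) ℂ)ˣ) : Matrix (Fin 2) (Fin 2) ℂ)) →
      ns (K - n) = Q'' (toL2S F K c₀ lam))
    (c : Site (F.P K) (K - n) → Matrix (Fin 2) (Fin 2) ℂ) :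
    ∃ lam : Site (F.P K) 0 → Matrix (Fin 2) (Fin 2) ℂ, Q'' (toL2S F K c₀ lam) = c := by
  classical
  set a : ℂ := (((Fintype.card (Fin (F.P K).d → Fin (F.P K).L) : ℂ))⁻¹) ^ (K - n) with ha
  have ha0 : a ≠ 0 := pow_ne_zero _ (inv_ne_zero (Nat.cast_ne_zero.2 Fintype.card_ne_zero))
  refine ⟨∑ y : Site (F.P K) (K - n), fun z => if z = embIter (K - n) y then a⁻¹ • c y else 0, ?_⟩
  rw [map_sum, map_sum]
  have hterm : ∀ y : Site (F.P K) (K - n), Q'' (toL2S F K c₀ (fun z => if z = embIter (K - n) y then a⁻¹ • c y else 0))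
      = fun w => if w = y then c y else 0 := by
    intro y
    rw [topMean_toL2S_single F h U₀ Q'' htop y (a⁻¹ • c y), ← ha]
    funext w
    by_cases hw : w = y
    · rw [if_pos hw, if_pos hw, smul_smul, mul_inv_cancel₀ ha0, one_smul]
    · rw [if_neg hw, if_neg hw]
  simp only [hterm]
  funext w
  rw [Finset.sum_apply, Finset.sum_ite_eq Finset.univ w, if_pos (Finset.mem_univ w)]

/-- ★ **RANGE FORM**: `range (Q″ ∘ toL2S) = ⊤`, i.e. `Q″` itself is surjective (since `toL2S` is an equivalence). [cite: Balaban1985BackgroundPropagators, (3.19) p.393] -/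
theorem surjective_topMean (h : n ≤ K) {c₀ : ℝ} (U₀ : GaugeField (F.P K) 0 (Matrix.specialUnitaryGroup (Fin 2) ℂ))
    (Q'' : SiteL2K ℂ 3 (periodsT3 F K) c₀ W₂ →ₗ[ℂ] (Site (F.P K) (K - n) → Matrix (Fin 2) (Fin 2) ℂ))
    (htop : ∀ (lam : Site (F.P K) 0 → Matrix (Fin 2) (Fin 2) ℂ) (ns : (j : ℕ) → Site (F.P K) j → Matrix (Fin 2) (Fin 2) ℂ), ns 0 = lam →
      (∀ (j : ℕ) (y : Site (F.P K) (j + 1)), ns (j + 1) y = ns j (emb y) - meanCLM (Idx (F.P K)) (Matrix (Fin 2) (Fin 2) ℂ) fun i : Idx (F.P K) =>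
        ns j (emb y) - ((holT (emlIterU j (bgUnits F K U₀)) (emb y) (stairWord i.2.1 (off i.1)) : (Matrix (Fin 2) (Fin 2) ℂ)ˣ) : Matrix (Fin 2) (Fin 2) ℂ) *
          ns j (transl (emb y) (disp (stairWord i.2.1 (off i.1)))) * (((holT (emlIterU j (bgUnits F K U₀)) (emb y) (stairWord i.2.1 (off i.1)))⁻¹ : (Matrix (Fin 2) (Fin 2) ℂ)ˣ) : Matrix (Fin 2) (Fin 2) ℂ)) →
      ns (K - n) = Q'' (toL2S F K c₀ lam)) :
    Function.Surjective Q'' := fun c => by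
  obtain ⟨lam, hlam⟩ := exists_preimage_topMean F h U₀ Q'' htop c
  exact ⟨toL2S F K c₀ lam, hlam⟩

end T3

end Summit.QuantumFields.YangMills.Theorems.Prop7TopMeanDeltaPreimage

end
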